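import Literature.NumberTheory.Automorphic.UnitaryGroupTorusRankOneInterval
import Literature.NumberTheory.Automorphic.UnitaryGroupTruncatedTraceClassElliptic
import Literature.NumberTheory.Automorphic.UnitaryGroupBorelModulusThree
import Literature.MeasureTheory.Group.InvariantQuotientNormalized
import Literature.MeasureTheory.Group.InvariantQuotientUnfoldingBochner
import HarnessLib

/-!
# The torus fibre of the weighted hyperbolic term on `U(J₃)`:
# `∫_{G(𝔸)} β(g) f(g⁻¹γg) u_T(g) dg = C · ∫_{G(𝔸)/T(𝔸)} f(x̃γx̃⁻¹)(2 log T − log H(x̃⁻¹) − log H(w x̃⁻¹)) dx`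
(Rogawski, *Automorphic Representations of Unitary Groups in Three Variables* (1990), §6.1,
(6.1.1)–(6.1.3): integration of Arthur's weight over the fibre `T(F)\T(𝔸)` of the unfolded hyperbolic
term; Arthur, *A trace formula for reductive groups I*, Duke Math. J. 45 (1978), §8)

Topic `NumberTheory/Automorphic`; namespace `Literature.NumberTheory.Automorphic.UnitaryGroup`. THEOREMS
ONLY over accepted tree modules (no definition, no named fact, no instance, no notation, no `sorry`).
Row (L5-ii) (W2-c) Step 2 («torus fibre») of the T1-qs LAW 5 road of
`Cruxes/H413/Lines/F0_T1InnerFormTraceIdentity.lean` (cell `pub/hodgecm-mathlib`, crux H413).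

SETTING. `G = U(J₃)` quasi-split (`quasiSplit F E c 3`), `T(𝔸) = torusAdelic F E c 3 ≤ G(𝔸_F)` the
adelic diagonal torus (closed, abelian), `ρ` a Haar measure on `T(𝔸)` (inversion invariant — automatic
for an abelian group, kept as a binder), `ν_G` a Haar measure of `G(𝔸_F)` (right and inversion
invariant: `G(𝔸_F)` is unimodular), `ν_G/ρ := quotientMeasure (torusAdelic F E c 3) ρ _ ν_G` the quotient
measure on `G(𝔸_F) ⧸ T(𝔸)` (★ `InvariantQuotientExistence`, Weil's formula with constant ONE ★
`lintegral_fiberLIntegral_quotientMeasure`), `γ ∈ T(𝔸)` (ONLY this is used: `t γ t⁻¹ = γ`; regularity of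
`γ` lives in the unfolding over `T(F)\G(𝔸)` of the sibling files), the Weyl element `w` in the hypothesis
style `hw : ↑↑w = !![0,0,1;0,1,0;1,0,0]` of ★ `UnitaryGroupHyperbolicBorelSlice`, a cut-off `T ≥ 1`, and a
Borel weight `β ≥ 0` on `G(𝔸_F)` whose torus translates `s ↦ β(s y)` are covering weights of the rational
torus `T(F)_T` (★ `UnitaryGroupTorusCoveringWeights`) — the shape in which the coset-sum unfolding over
`T(F)\G(𝔸)` (★ `UnitaryGroupSubgroupCosetSumUnfolding`, `Λ = G_γ(F) = T(F)`) delivers its weight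
(bridge `isCoveringWeight_torus_translate`). Arthur's weight is
`u_T(z) := 1 − 1_{T < H(z)} − 1_{T < H(w z)}` INLINE (`H = borelHeight`).

* §1 letters: `isClosed_torusAdelic`, `mul_comm_of_mem_torusAdelic`, `uT_eq_indicator_truncated`
  (`u_T = 1_{H ≤ T ∧ H∘w ≤ T} ≥ 0` on ALL of `G(𝔸_F)`, since `H(wz)H(z) ≤ 1 ≤ T²`),
  `mem_truncated_torus_coe_mul_iff` (the truncated set along a torus translate is the (W3) window),
  `borelHeight_mul_borelHeight_weyl_torus_coe_mul` / `log_borelHeight_add_log_borelHeight_weyl_torus_mul`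
  (the weight `log H(y) + log H(w y)` is `T(𝔸)`-invariant), `isCoveringWeight_torus_translate`.
* §2 the fibre: `lintegral_torusAdelic_weight_mul_indicator_eq` and `integral_torusAdelic_weight_mul_uT_eq`
  — `∫_{T(𝔸)} β(t y) u_T(t y) dρ(t) = C · (2 log T − log H(y) − log H(w y))`, `C` THE window constant
  (★ `exists_rankOneInterval_forall_weight`, transported along `T(𝔸) ≅ T(𝔸)_B = torusInBorel`).
* §3 `[0,∞]` UNFOLDING **`lintegral_weight_mul_enorm_conj_mul_indicator_eq`**:
  `∫⁻ β(g) ‖f(g⁻¹γg)‖ 1_{trunc}(g) dν_G = C · ∫⁻_{G⧸T(𝔸)} ‖f(x̃γx̃⁻¹)‖ · (2 log T − log H(x̃⁻¹) − log H(wx̃⁻¹))`.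
* §4 SIGNED UNFOLDING **`integral_weight_toReal_mul_conj_mul_uT_eq`** under
  `hint : ∫⁻_{G⧸T(𝔸)} ‖f(x̃γx̃⁻¹)‖ · (2 log T − log H(x̃⁻¹) − log H(wx̃⁻¹)) < ∞` (compact support of the
  regular hyperbolic orbit — ★-pending `UnitaryGroupHyperbolicOrbitCompactSupport`), with integrability
  of the group-side integrand.
* §5 **`exists_torusFibre_unfolding`** — the packaged `∃ C ≠ ⊤` (window law for every covering weight of
  `T(F)_T` ∧ §3 ∧ §4), so the assembly identifies `C` with the slope of the `2 log T` term of LAW 2.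

## References
* J. D. Rogawski, *Automorphic Representations of Unitary Groups in Three Variables*, Ann. of Math.
  Stud. 123 (1990), §6.1 pp. 79–81, (6.1.1)–(6.1.3) [Rogawski1990].
* J. Arthur, *A trace formula for reductive groups I*, Duke Math. J. 45 (1978), §8 [Arthur1978TraceFormulaI].
* A. Deitmar, S. Echterhoff, *Principles of Harmonic Analysis*, 2nd ed. (2014), Thm. 1.5.3
  [DeitmarEchterhoff2014].
-/

set_option autoImplicit false

noncomputable section

open MeasureTheory Measure NumberField IsDedekindDomain Set Filter Literature.MeasureTheory.Group
open scoped NNReal ENNReal Pointwise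

namespace Literature.NumberTheory.Automorphic

namespace UnitaryGroup

variable {F E : Type} [Field F] [NumberField F] [Field E] [NumberField E] [Algebra F E]
  {c : E ≃ₐ[F] E}

/-! ## §1 Letters -/

section Letters

variable {N : ℕ}

/-- **`T(𝔸_F)` is closed in `G(𝔸_F)`** (it is closed in the closed subgroup `B(𝔸_F)`: ★
`isTopSemidirect_borelAdelic.isClosed_left`, ★ `isClosed_borelAdelic`). [cite: Rogawski1990, §1.10] -/
theorem isClosed_torusAdelic : IsClosed {g : (quasiSplit F E c N).Adelic | g ∈ torusAdelic F E c N} := by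
  change IsClosed ((torusAdelic F E c N : Set (quasiSplit F E c N).Adelic))
  have hB : IsClosed ((borelAdelic F E c N : Set (quasiSplit F E c N).Adelic)) := isClosed_borelAdelic
  have hT : IsClosed ((torusInBorel F E c N : Set (borelAdelic F E c N))) :=
    (isTopSemidirect_borelAdelic (F := F) (E := E) (c := c) (N := N)).isClosed_left
  have himg : ((torusAdelic F E c N : Set (quasiSplit F E c N).Adelic)) =
      ((↑) : borelAdelic F E c N → (quasiSplit F E c N).Adelic) '' (torusInBorel F E c N : Set (borelAdelic F E c N)) := by
    ext g
    constructor
    · intro hg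
      exact ⟨⟨g, torusAdelic_le_borelAdelic hg⟩, hg, rfl⟩
    · rintro ⟨b, hb, rfl⟩
      exact hb
  rw [himg]
  exact hB.isClosedEmbedding_subtypeVal.isClosedMap _ hT

/-- **`T(𝔸_F)` is abelian**: `a b = b a` for `a, b ∈ T(𝔸_F)` (★ `torusInBorel_comm`). [cite: Rogawski1990, §1.10] -/
theorem mul_comm_of_mem_torusAdelic {a b : (quasiSplit F E c N).Adelic} (ha : a ∈ torusAdelic F E c N)
    (hb : b ∈ torusAdelic F E c N) : a * b = b * a := by
  have h := torusInBorel_comm (⟨⟨a, torusAdelic_le_borelAdelic ha⟩, ha⟩ : torusInBorel F E c N)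
    ⟨⟨b, torusAdelic_le_borelAdelic hb⟩, hb⟩
  exact congrArg (fun t : torusInBorel F E c N => ((t : borelAdelic F E c N) : (quasiSplit F E c N).Adelic)) h

end Letters

section Weight

/-- **Arthur's weight is the indicator of the truncated region** (on ALL of `G(𝔸_F)`, `T ≥ 1`):
`u_T(z) := 1 − 1_{T < H(z)} − 1_{T < H(w z)} = 1_{H(z) ≤ T ∧ H(w z) ≤ T}(z)` — the two cut-offs never hold
together since `H(w z) H(z) ≤ 1 ≤ T²` (★ `borelHeight_toAdelic_weyl_mul_mul_le_one`); in particular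
`u_T ≥ 0`. [cite: Rogawski1990, §6.1 (pp. 79–81)] [cite: Arthur1978TraceFormulaI, §8] -/
theorem uT_eq_indicator_truncated {w : (quasiSplit F E c 3).Rational}
    (hw : ((w.1 : GL (Fin 3) E) : Matrix (Fin 3) (Fin 3) E) = !![(0 : E), 0, 1; 0, 1, 0; 1, 0, 0])
    {T : ℝ≥0} (hT : 1 ≤ T) (z : (quasiSplit F E c 3).Adelic) :
    (1 : ℝ) - {g : (quasiSplit F E c 3).Adelic | T < borelHeight g}.indicator 1 z -
      {g : (quasiSplit F E c 3).Adelic | T < borelHeight g}.indicator 1 ((quasiSplit F E c 3).toAdelic w * z) =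
      {g : (quasiSplit F E c 3).Adelic | borelHeight g ≤ T ∧
        borelHeight ((quasiSplit F E c 3).toAdelic w * g) ≤ T}.indicator 1 z := by
  have hle1 := borelHeight_toAdelic_weyl_mul_mul_le_one hw z
  have hdisj : T < borelHeight z → ¬ T < borelHeight ((quasiSplit F E c 3).toAdelic w * z) := by
    intro h1 h2
    have h12 : T * T < borelHeight ((quasiSplit F E c 3).toAdelic w * z) * borelHeight z :=
      mul_lt_mul'' h2 h1 zero_le zero_le
    have hT2 : (1 : ℝ≥0) ≤ T * T := by
      calc (1 : ℝ≥0) = 1 * 1 := (mul_one 1).symm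
        _ ≤ T * T := mul_le_mul' hT hT
    exact absurd (lt_of_le_of_lt hT2 (lt_of_lt_of_le h12 hle1)) (lt_irrefl 1)
  simp only [Set.indicator_apply, Set.mem_setOf_eq, Pi.one_apply, not_lt.symm]
  by_cases h1 : T < borelHeight z
  · have h2 := hdisj h1
    simp [h1, h2]
  · by_cases h2 : T < borelHeight ((quasiSplit F E c 3).toAdelic w * z)
    · simp [h1, h2]
    · simp [h1, h2]

/-- **The truncated region along a torus translate is the rank-one window**: for `t ∈ T(𝔸_F)_B`,
`t y ∈ {H ≤ T ∧ H∘w ≤ T} ↔ H(1) H(wy)/T ≤ H(t) ≤ H(1) T/H(y)` (★ `borelHeight_torus_coe_mul`,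
★ `borelHeight_toAdelic_weyl_mul_torus_coe_mul`, ★ `borelHeight_torus_coe`).
[cite: Rogawski1990, §6.1 (pp. 79–81)] -/
theorem mem_truncated_torus_coe_mul_iff {w : (quasiSplit F E c 3).Rational}
    (hw : ((w.1 : GL (Fin 3) E) : Matrix (Fin 3) (Fin 3) E) = !![(0 : E), 0, 1; 0, 1, 0; 1, 0, 0])
    {T : ℝ≥0} (hT : 1 ≤ T) (t : torusInBorel F E c 3) (y : (quasiSplit F E c 3).Adelic) :
    (((t : borelAdelic F E c 3) : (quasiSplit F E c 3).Adelic) * y ∈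
        {g : (quasiSplit F E c 3).Adelic | borelHeight g ≤ T ∧
          borelHeight ((quasiSplit F E c 3).toAdelic w * g) ≤ T}) ↔
      t ∈ {t : torusInBorel F E c 3 |
          borelHeight (1 : (quasiSplit F E c 3).Adelic) * borelHeight ((quasiSplit F E c 3).toAdelic w * y) / T ≤
            borelHeight (((t : torusInBorel F E c 3) : borelAdelic F E c 3) : (quasiSplit F E c 3).Adelic) ∧
          borelHeight (((t : torusInBorel F E c 3) : borelAdelic F E c 3) : (quasiSplit F E c 3).Adelic) ≤
            borelHeight (1 : (quasiSplit F E c 3).Adelic) * T / borelHeight y} := by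
  -- both sides are the supports of indicators that agree as real numbers
  have h1 := uT_eq_indicator_truncated hw hT ((((t : borelAdelic F E c 3) : (quasiSplit F E c 3).Adelic)) * y)
  have h2 := uT_torus_coe_mul_eq_indicator hw hT t y
  rw [h1] at h2
  constructor
  · intro h
    by_contra h'
    rw [Set.indicator_of_mem h, Set.indicator_of_notMem h'] at h2
    exact one_ne_zero h2
  · intro h
    by_contra h'
    rw [Set.indicator_of_notMem h', Set.indicator_of_mem h] at h2
    exact zero_ne_one h2

/-- **The weight `H(y) · H(w y)` is `T(𝔸_F)`-invariant**: `H(t y) · H(w t y) = H(y) · H(w y)` for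
`t ∈ T(𝔸_F)_B` (`‖d₀ t‖ · ‖d₀ t‖⁻¹ = 1`). [cite: Rogawski1990, §6.1 (pp. 79–81)] -/
theorem borelHeight_mul_borelHeight_weyl_torus_coe_mul {w : (quasiSplit F E c 3).Rational}
    (hw : ((w.1 : GL (Fin 3) E) : Matrix (Fin 3) (Fin 3) E) = !![(0 : E), 0, 1; 0, 1, 0; 1, 0, 0])
    (t : torusInBorel F E c 3) (y : (quasiSplit F E c 3).Adelic) :
    borelHeight (((t : borelAdelic F E c 3) : (quasiSplit F E c 3).Adelic) * y) *
        borelHeight ((quasiSplit F E c 3).toAdelic w * ((((t : borelAdelic F E c 3) : (quasiSplit F E c 3).Adelic)) * y)) =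
      borelHeight y * borelHeight ((quasiSplit F E c 3).toAdelic w * y) := by
  rw [borelHeight_torus_coe_mul, borelHeight_toAdelic_weyl_mul_torus_coe_mul hw]
  have hn : IdeleClassGroup.ideleNorm E (diagUnit (t : borelAdelic F E c 3).2 0) ≠ 0 := ideleNorm_ne_zero _
  calc IdeleClassGroup.ideleNorm E (diagUnit (t : borelAdelic F E c 3).2 0) * borelHeight y *
        ((IdeleClassGroup.ideleNorm E (diagUnit (t : borelAdelic F E c 3).2 0))⁻¹ *
          borelHeight ((quasiSplit F E c 3).toAdelic w * y))
      = (IdeleClassGroup.ideleNorm E (diagUnit (t : borelAdelic F E c 3).2 0) *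
          (IdeleClassGroup.ideleNorm E (diagUnit (t : borelAdelic F E c 3).2 0))⁻¹) *
          (borelHeight y * borelHeight ((quasiSplit F E c 3).toAdelic w * y)) := by ring
    _ = borelHeight y * borelHeight ((quasiSplit F E c 3).toAdelic w * y) := by
        rw [mul_inv_cancel₀ hn, one_mul]

/-- The same for `t ∈ T(𝔸) = torusAdelic` and in logarithmic form: **`log H(t y) + log H(w t y) =
log H(y) + log H(w y)`** — Arthur's weight `2 log T − log H(y) − log H(w y)` descends to `G(𝔸) ⧸ T(𝔸)`
(acting on `y⁻¹`: `y ↦ y t⁻¹`). [cite: Rogawski1990, §6.1 (pp. 79–81)] -/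
theorem log_borelHeight_add_log_borelHeight_weyl_torus_mul {w : (quasiSplit F E c 3).Rational}
    (hw : ((w.1 : GL (Fin 3) E) : Matrix (Fin 3) (Fin 3) E) = !![(0 : E), 0, 1; 0, 1, 0; 1, 0, 0])
    {t : (quasiSplit F E c 3).Adelic} (ht : t ∈ torusAdelic F E c 3) (y : (quasiSplit F E c 3).Adelic) :
    Real.log (borelHeight (t * y) : ℝ) + Real.log (borelHeight ((quasiSplit F E c 3).toAdelic w * (t * y)) : ℝ) =
      Real.log (borelHeight y : ℝ) + Real.log (borelHeight ((quasiSplit F E c 3).toAdelic w * y) : ℝ) := by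
  have h := borelHeight_mul_borelHeight_weyl_torus_coe_mul hw
    (⟨⟨t, torusAdelic_le_borelAdelic ht⟩, ht⟩ : torusInBorel F E c 3) y
  have hpos : ∀ g : (quasiSplit F E c 3).Adelic, (0 : ℝ) < borelHeight g := fun g => NNReal.coe_pos.2 (borelHeight_pos g)
  rw [← Real.log_mul (hpos _).ne' (hpos _).ne', ← Real.log_mul (hpos _).ne' (hpos _).ne']
  congr 1
  exact_mod_cast h

variable [MeasurableSpace (quasiSplit F E c 3).Adelic]

/-- **BRIDGE: translated torus weights.** If `β` is a covering weight on `G(𝔸_F)` of the image `Λ♯` of a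
subgroup `Λ ≤ G(F)` whose members are exactly the rational elements of `T(𝔸)` (`hΛ`; for the hyperbolic
row `Λ = G_γ(F)`, the rational centraliser of a regular diagonal `γ`), then for every `y` the translate
`s ↦ β(s y)` is a covering weight of the rational torus `T(F)_T` acting on `T(𝔸_F)_B = torusInBorel`
(the weight shape of ★ `exists_rankOneInterval_forall_weight`). [cite: Arthur1978TraceFormulaI, §8] -/
theorem isCoveringWeight_torus_translate [BorelSpace (quasiSplit F E c 3).Adelic]
    {Λ : Subgroup (quasiSplit F E c 3).arithmeticSubgroup} {β : (quasiSplit F E c 3).Adelic → ℝ≥0∞}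
    (hβ : IsCoveringWeight (Λ.map (quasiSplit F E c 3).arithmeticSubgroup.subtype) β)
    (hΛ : ∀ δ : (quasiSplit F E c 3).arithmeticSubgroup,
      δ ∈ Λ ↔ (δ : (quasiSplit F E c 3).Adelic) ∈ torusAdelic F E c 3)
    (y : (quasiSplit F E c 3).Adelic) :
    IsCoveringWeight ((rationalBorel F E c 3).subgroupOf (torusInBorel F E c 3))
      (fun s : torusInBorel F E c 3 => β ((((s : borelAdelic F E c 3) : (quasiSplit F E c 3).Adelic)) * y)) := by
  refine ⟨hβ.measurable.comp ((measurable_subtype_coe.comp measurable_subtype_coe).mul_const y), fun s => ?_⟩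
  -- `T(F)_T ≃ Λ♯`, `τ ↦ ↑↑τ`
  have hmemΛ : ∀ τ : (rationalBorel F E c 3).subgroupOf (torusInBorel F E c 3),
      ((((τ : torusInBorel F E c 3) : borelAdelic F E c 3) : (quasiSplit F E c 3).Adelic)) ∈
        Λ.map (quasiSplit F E c 3).arithmeticSubgroup.subtype := by
    intro τ
    have hτ : (((τ : torusInBorel F E c 3) : borelAdelic F E c 3) : (quasiSplit F E c 3).Adelic) ∈
        (quasiSplit F E c 3).arithmeticSubgroup := τ.2
    refine ⟨⟨_, hτ⟩, (hΛ ⟨_, hτ⟩).2 (τ : torusInBorel F E c 3).2, rfl⟩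
  set e : (rationalBorel F E c 3).subgroupOf (torusInBorel F E c 3) →
      Λ.map (quasiSplit F E c 3).arithmeticSubgroup.subtype := fun τ => ⟨_, hmemΛ τ⟩ with he
  have hebij : Function.Bijective e := by
    constructor
    · intro τ₁ τ₂ h
      have h' := congrArg (fun x : Λ.map (quasiSplit F E c 3).arithmeticSubgroup.subtype =>
        (x : (quasiSplit F E c 3).Adelic)) h
      exact Subtype.ext (Subtype.ext (Subtype.ext h'))
    · rintro ⟨x, δ, hδ, rfl⟩
      have hδT : ((δ : (quasiSplit F E c 3).arithmeticSubgroup) : (quasiSplit F E c 3).Adelic) ∈ torusAdelic F E c 3 :=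
        (hΛ δ).1 hδ
      refine ⟨⟨⟨⟨(δ : (quasiSplit F E c 3).Adelic), torusAdelic_le_borelAdelic hδT⟩, hδT⟩, ?_⟩, rfl⟩
      change (⟨(δ : (quasiSplit F E c 3).Adelic), torusAdelic_le_borelAdelic hδT⟩ : borelAdelic F E c 3) ∈
        rationalBorel F E c 3
      exact δ.2
  have hcov := hβ.coveringSum_eq ((((s : torusInBorel F E c 3) : borelAdelic F E c 3) : (quasiSplit F E c 3).Adelic) * y)
  rw [coveringSum_apply] at hcov ⊢
  rw [← hcov, ← (Equiv.ofBijective e hebij).tsum_eq]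
  refine tsum_congr fun τ => ?_
  simp only [Equiv.ofBijective_apply, Subgroup.smul_def, smul_eq_mul, Subgroup.coe_mul, mul_assoc]
  rfl

end Weight

/-! ## §2 The fibre integral over `T(𝔸)` -/

section Fibre

variable [MeasurableSpace (quasiSplit F E c 3).Adelic] [BorelSpace (quasiSplit F E c 3).Adelic]

omit [BorelSpace (quasiSplit F E c 3).Adelic] in
/-- Transport of `[0,∞]`-integrals along the canonical `T(𝔸) ≃ T(𝔸)_B` (plumbing). [folklore] -/
private theorem lintegral_map_torusEquiv (ρ : Measure ↥(torusAdelic F E c 3)) (Φ : torusInBorel F E c 3 → ℝ≥0∞) :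
    ∫⁻ s : torusInBorel F E c 3, Φ s ∂(Measure.map (⇑(Subgroup.subgroupOfEquivOfLe
        (torusAdelic_le_borelAdelic (F := F) (E := E) (c := c) (N := 3))).symm) ρ : Measure (torusInBorel F E c 3)) =
      ∫⁻ t : ↥(torusAdelic F E c 3), Φ ((Subgroup.subgroupOfEquivOfLe
        (torusAdelic_le_borelAdelic (F := F) (E := E) (c := c) (N := 3))).symm t) ∂ρ := by
  set em : ↥(torusAdelic F E c 3) ≃ᵐ torusInBorel F E c 3 :=
    { toFun := fun t => ⟨⟨(t : (quasiSplit F E c 3).Adelic), torusAdelic_le_borelAdelic t.2⟩, t.2⟩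
      invFun := fun s => ⟨((s : borelAdelic F E c 3) : (quasiSplit F E c 3).Adelic), s.2⟩
      left_inv := fun _ => rfl
      right_inv := fun _ => rfl
      measurable_toFun := (measurable_subtype_coe.subtype_mk).subtype_mk
      measurable_invFun := (measurable_subtype_coe.comp measurable_subtype_coe).subtype_mk } with hem
  have hmap : (Measure.map (⇑(Subgroup.subgroupOfEquivOfLe
      (torusAdelic_le_borelAdelic (F := F) (E := E) (c := c) (N := 3))).symm) ρ : Measure (torusInBorel F E c 3)) =
      Measure.map em ρ := rfl
  rw [hmap, lintegral_map_equiv]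
  rfl

omit [BorelSpace (quasiSplit F E c 3).Adelic] in
/-- Transport of Bochner integrals along the canonical `T(𝔸) ≃ T(𝔸)_B` (plumbing). [folklore] -/
private theorem integral_map_torusEquiv (ρ : Measure ↥(torusAdelic F E c 3)) (Φ : torusInBorel F E c 3 → ℝ) :
    ∫ s : torusInBorel F E c 3, Φ s ∂(Measure.map (⇑(Subgroup.subgroupOfEquivOfLe
        (torusAdelic_le_borelAdelic (F := F) (E := E) (c := c) (N := 3))).symm) ρ : Measure (torusInBorel F E c 3)) =
      ∫ t : ↥(torusAdelic F E c 3), Φ ((Subgroup.subgroupOfEquivOfLe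
        (torusAdelic_le_borelAdelic (F := F) (E := E) (c := c) (N := 3))).symm t) ∂ρ := by
  set em : ↥(torusAdelic F E c 3) ≃ᵐ torusInBorel F E c 3 :=
    { toFun := fun t => ⟨⟨(t : (quasiSplit F E c 3).Adelic), torusAdelic_le_borelAdelic t.2⟩, t.2⟩
      invFun := fun s => ⟨((s : borelAdelic F E c 3) : (quasiSplit F E c 3).Adelic), s.2⟩
      left_inv := fun _ => rfl
      right_inv := fun _ => rfl
      measurable_toFun := (measurable_subtype_coe.subtype_mk).subtype_mk
      measurable_invFun := (measurable_subtype_coe.comp measurable_subtype_coe).subtype_mk } with hem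
  have hmap : (Measure.map (⇑(Subgroup.subgroupOfEquivOfLe
      (torusAdelic_le_borelAdelic (F := F) (E := E) (c := c) (N := 3))).symm) ρ : Measure (torusInBorel F E c 3)) =
      Measure.map em ρ := rfl
  rw [hmap, integral_map_equiv]
  rfl

/-- **THE TORUS FIBRE, `[0,∞]` FORM.** With `e : T(𝔸) ≅ T(𝔸)_B` the canonical identification
(`Subgroup.subgroupOfEquivOfLe`, inverse direction) and `μ_T := e_* ρ`, suppose the torus window law holds
with constant `C` for every covering weight of `T(F)_T` (★ `exists_rankOneInterval_forall_weight`). Then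
for every `y ∈ G(𝔸_F)` and `T ≥ 1`:
`∫⁻_{T(𝔸)} β(t y) · 1_{H ≤ T ∧ H∘w ≤ T}(t y) dρ(t) = C · (2 log T − log H(y) − log H(w y))`.
[cite: Rogawski1990, §6.1 (6.1.2)–(6.1.3)] [cite: Arthur1978TraceFormulaI, §8] -/
theorem lintegral_torusAdelic_weight_mul_indicator_eq {w : (quasiSplit F E c 3).Rational}
    (hw : ((w.1 : GL (Fin 3) E) : Matrix (Fin 3) (Fin 3) E) = !![(0 : E), 0, 1; 0, 1, 0; 1, 0, 0])
    {T : ℝ≥0} (hT : 1 ≤ T) (ρ : Measure ↥(torusAdelic F E c 3))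
    {β : (quasiSplit F E c 3).Adelic → ℝ≥0∞}
    (hβT : ∀ y : (quasiSplit F E c 3).Adelic,
      IsCoveringWeight ((rationalBorel F E c 3).subgroupOf (torusInBorel F E c 3))
        (fun s : torusInBorel F E c 3 => β ((((s : borelAdelic F E c 3) : (quasiSplit F E c 3).Adelic)) * y)))
    {C : ℝ≥0∞} (hC : C ≠ ⊤)
    (hwin : ∀ β' : torusInBorel F E c 3 → ℝ≥0∞,
      IsCoveringWeight ((rationalBorel F E c 3).subgroupOf (torusInBorel F E c 3)) β' →
      ∀ A B : ℝ≥0, 0 < A → A ≤ B →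
        ∫⁻ s : torusInBorel F E c 3, β' s * {s : torusInBorel F E c 3 |
            A < borelHeight (((s : torusInBorel F E c 3) : borelAdelic F E c 3) : (quasiSplit F E c 3).Adelic) ∧
            borelHeight (((s : torusInBorel F E c 3) : borelAdelic F E c 3) : (quasiSplit F E c 3).Adelic) ≤ B}.indicator
            1 s ∂(Measure.map (⇑(Subgroup.subgroupOfEquivOfLe
              (torusAdelic_le_borelAdelic (F := F) (E := E) (c := c) (N := 3))).symm) ρ :
                Measure (torusInBorel F E c 3)) =
          C * ENNReal.ofReal (Real.log (B : ℝ) - Real.log (A : ℝ)))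
    (y : (quasiSplit F E c 3).Adelic) :
    ∫⁻ t : ↥(torusAdelic F E c 3), β ((t : (quasiSplit F E c 3).Adelic) * y) *
        {g : (quasiSplit F E c 3).Adelic | borelHeight g ≤ T ∧
          borelHeight ((quasiSplit F E c 3).toAdelic w * g) ≤ T}.indicator 1 ((t : (quasiSplit F E c 3).Adelic) * y) ∂ρ =
      C * ENNReal.ofReal (2 * Real.log (T : ℝ) - Real.log (borelHeight y : ℝ) -
        Real.log (borelHeight ((quasiSplit F E c 3).toAdelic w * y) : ℝ)) := by
  -- transport to `T(𝔸)_B` and apply the window law through (W3)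
  have hW3 := lintegral_weight_mul_indicator_rankOneWindow_eq hw y hT
    (Measure.map (⇑(Subgroup.subgroupOfEquivOfLe
      (torusAdelic_le_borelAdelic (F := F) (E := E) (c := c) (N := 3))).symm) ρ : Measure (torusInBorel F E c 3))
    (hβT y).measurable hC (hwin _ (hβT y))
  rw [lintegral_map_torusEquiv] at hW3
  rw [← hW3]
  refine lintegral_congr fun t => ?_
  set s : torusInBorel F E c 3 := (Subgroup.subgroupOfEquivOfLe
    (torusAdelic_le_borelAdelic (F := F) (E := E) (c := c) (N := 3))).symm t with hs
  have hcoe : (((s : torusInBorel F E c 3) : borelAdelic F E c 3) : (quasiSplit F E c 3).Adelic) =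
      (t : (quasiSplit F E c 3).Adelic) := rfl
  rw [hcoe]
  congr 1
  by_cases h : (t : (quasiSplit F E c 3).Adelic) * y ∈ {g : (quasiSplit F E c 3).Adelic | borelHeight g ≤ T ∧
      borelHeight ((quasiSplit F E c 3).toAdelic w * g) ≤ T}
  · rw [Set.indicator_of_mem h, Set.indicator_of_mem ((mem_truncated_torus_coe_mul_iff hw hT s y).1 (hcoe ▸ h))]
    rfl
  · rw [Set.indicator_of_notMem h,
      Set.indicator_of_notMem (fun h' => h (hcoe ▸ (mem_truncated_torus_coe_mul_iff hw hT s y).2 h'))]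

/-- **THE TORUS FIBRE, SIGNED FORM**: `∫_{T(𝔸)} β(t y) u_T(t y) dρ(t) = C · (2 log T − log H(y) − log H(w y))`
(`u_T` inline). [cite: Rogawski1990, §6.1 (6.1.2)–(6.1.3)] [cite: Arthur1978TraceFormulaI, §8] -/
theorem integral_torusAdelic_weight_mul_uT_eq {w : (quasiSplit F E c 3).Rational}
    (hw : ((w.1 : GL (Fin 3) E) : Matrix (Fin 3) (Fin 3) E) = !![(0 : E), 0, 1; 0, 1, 0; 1, 0, 0])
    {T : ℝ≥0} (hT : 1 ≤ T) (ρ : Measure ↥(torusAdelic F E c 3))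
    {β : (quasiSplit F E c 3).Adelic → ℝ≥0∞}
    (hβT : ∀ y : (quasiSplit F E c 3).Adelic,
      IsCoveringWeight ((rationalBorel F E c 3).subgroupOf (torusInBorel F E c 3))
        (fun s : torusInBorel F E c 3 => β ((((s : borelAdelic F E c 3) : (quasiSplit F E c 3).Adelic)) * y)))
    {C : ℝ≥0∞} (hC : C ≠ ⊤)
    (hwin : ∀ β' : torusInBorel F E c 3 → ℝ≥0∞,
      IsCoveringWeight ((rationalBorel F E c 3).subgroupOf (torusInBorel F E c 3)) β' →
      ∀ A B : ℝ≥0, 0 < A → A ≤ B →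
        ∫⁻ s : torusInBorel F E c 3, β' s * {s : torusInBorel F E c 3 |
            A < borelHeight (((s : torusInBorel F E c 3) : borelAdelic F E c 3) : (quasiSplit F E c 3).Adelic) ∧
            borelHeight (((s : torusInBorel F E c 3) : borelAdelic F E c 3) : (quasiSplit F E c 3).Adelic) ≤ B}.indicator
            1 s ∂(Measure.map (⇑(Subgroup.subgroupOfEquivOfLe
              (torusAdelic_le_borelAdelic (F := F) (E := E) (c := c) (N := 3))).symm) ρ :
                Measure (torusInBorel F E c 3)) =
          C * ENNReal.ofReal (Real.log (B : ℝ) - Real.log (A : ℝ)))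
    (y : (quasiSplit F E c 3).Adelic) :
    ∫ t : ↥(torusAdelic F E c 3), (β ((t : (quasiSplit F E c 3).Adelic) * y)).toReal *
        ((1 : ℝ) - {g : (quasiSplit F E c 3).Adelic | T < borelHeight g}.indicator 1 ((t : (quasiSplit F E c 3).Adelic) * y) -
          {g : (quasiSplit F E c 3).Adelic | T < borelHeight g}.indicator 1
            ((quasiSplit F E c 3).toAdelic w * ((t : (quasiSplit F E c 3).Adelic) * y))) ∂ρ =
      C.toReal * (2 * Real.log (T : ℝ) - Real.log (borelHeight y : ℝ) -
        Real.log (borelHeight ((quasiSplit F E c 3).toAdelic w * y) : ℝ)) := by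
  have hW3 := integral_weight_toReal_mul_uT_eq hw y hT
    (Measure.map (⇑(Subgroup.subgroupOfEquivOfLe
      (torusAdelic_le_borelAdelic (F := F) (E := E) (c := c) (N := 3))).symm) ρ : Measure (torusInBorel F E c 3))
    (hβT y).measurable hC (hwin _ (hβT y))
  rw [integral_map_torusEquiv] at hW3
  exact hW3

end Fibre

/-! ## §3 The `[0,∞]` unfolding along `T(𝔸)` -/

section Unfold

variable [MeasurableSpace (quasiSplit F E c 3).Adelic] [BorelSpace (quasiSplit F E c 3).Adelic]
  [MeasurableSpace ((quasiSplit F E c 3).Adelic ⧸ torusAdelic F E c 3)]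
  [BorelSpace ((quasiSplit F E c 3).Adelic ⧸ torusAdelic F E c 3)]

/-- **UNFOLDING OF THE WEIGHTED HYPERBOLIC TERM ALONG `T(𝔸)`, `[0,∞]` FORM.** For `γ ∈ T(𝔸)`, the Weyl
element `w`, `T ≥ 1`, Haar measures `ν_G` on `G(𝔸_F)` (right and inversion invariant) and `ρ` on `T(𝔸)`
(inversion invariant), a Borel `β ≥ 0` whose torus translates are covering weights of `T(F)_T`, the window
constant `C` of `μ_T := e_* ρ`, and a Borel `f : G(𝔸_F) → ℂ`:
`∫⁻ β(g) ‖f(g⁻¹ γ g)‖ 1_{H ≤ T ∧ H∘w ≤ T}(g) dν_G(g)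
   = C · ∫⁻_{G(𝔸) ⧸ T(𝔸)} ‖f(x̃ γ x̃⁻¹)‖ · (2 log T − log H(x̃⁻¹) − log H(w x̃⁻¹)) d(ν_G/ρ)(x)` (`x̃ = x.out`)
— inversion `g ↦ g⁻¹`, Weil's formula along the closed subgroup `T(𝔸)` with constant one
(★ `lintegral_fiberLIntegral_quotientMeasure`), `t γ t⁻¹ = γ` in the fibre, and §2. This discharges the
finiteness input of the Bochner coset-sum unfolding over `T(F)\G(𝔸)` from the finiteness of the right-hand
side. [cite: Rogawski1990, §6.1 (6.1.1)–(6.1.3)] [cite: Arthur1978TraceFormulaI, §8]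
[cite: DeitmarEchterhoff2014, Thm. 1.5.3] -/
theorem lintegral_weight_mul_enorm_conj_mul_indicator_eq
    {γ : (quasiSplit F E c 3).Adelic} (hγ : γ ∈ torusAdelic F E c 3)
    {w : (quasiSplit F E c 3).Rational}
    (hw : ((w.1 : GL (Fin 3) E) : Matrix (Fin 3) (Fin 3) E) = !![(0 : E), 0, 1; 0, 1, 0; 1, 0, 0])
    {T : ℝ≥0} (hT : 1 ≤ T)
    (νG : Measure (quasiSplit F E c 3).Adelic) [νG.IsHaarMeasure] [νG.IsMulRightInvariant] [νG.IsInvInvariant]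
    (ρ : Measure ↥(torusAdelic F E c 3)) [ρ.IsHaarMeasure] [ρ.IsInvInvariant]
    {β : (quasiSplit F E c 3).Adelic → ℝ≥0∞} (hβm : Measurable β)
    (hβT : ∀ y : (quasiSplit F E c 3).Adelic,
      IsCoveringWeight ((rationalBorel F E c 3).subgroupOf (torusInBorel F E c 3))
        (fun s : torusInBorel F E c 3 => β ((((s : borelAdelic F E c 3) : (quasiSplit F E c 3).Adelic)) * y)))
    {C : ℝ≥0∞} (hC : C ≠ ⊤)
    (hwin : ∀ β' : torusInBorel F E c 3 → ℝ≥0∞,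
      IsCoveringWeight ((rationalBorel F E c 3).subgroupOf (torusInBorel F E c 3)) β' →
      ∀ A B : ℝ≥0, 0 < A → A ≤ B →
        ∫⁻ s : torusInBorel F E c 3, β' s * {s : torusInBorel F E c 3 |
            A < borelHeight (((s : torusInBorel F E c 3) : borelAdelic F E c 3) : (quasiSplit F E c 3).Adelic) ∧
            borelHeight (((s : torusInBorel F E c 3) : borelAdelic F E c 3) : (quasiSplit F E c 3).Adelic) ≤ B}.indicator
            1 s ∂(Measure.map (⇑(Subgroup.subgroupOfEquivOfLe
              (torusAdelic_le_borelAdelic (F := F) (E := E) (c := c) (N := 3))).symm) ρ :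
                Measure (torusInBorel F E c 3)) =
          C * ENNReal.ofReal (Real.log (B : ℝ) - Real.log (A : ℝ)))
    {f : (quasiSplit F E c 3).Adelic → ℂ} (hf : Measurable f) :
    haveI := t2Space_quasiSplitAdelic (F := F) (E := E) (c := c) (N := 3)
    haveI := locallyCompactSpace_quasiSplitAdelic (F := F) (E := E) (c := c) (N := 3)
    haveI := secondCountableTopology_quasiSplitAdelic (F := F) (E := E) (c := c) (N := 3)
    ∫⁻ g, β g * ‖f (g⁻¹ * γ * g)‖ₑ *
        {g : (quasiSplit F E c 3).Adelic | borelHeight g ≤ T ∧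
          borelHeight ((quasiSplit F E c 3).toAdelic w * g) ≤ T}.indicator 1 g ∂νG =
      C * ∫⁻ x : (quasiSplit F E c 3).Adelic ⧸ torusAdelic F E c 3,
        ‖f ((x.out : (quasiSplit F E c 3).Adelic) * γ * (x.out : (quasiSplit F E c 3).Adelic)⁻¹)‖ₑ *
          ENNReal.ofReal (2 * Real.log (T : ℝ) - Real.log (borelHeight (x.out : (quasiSplit F E c 3).Adelic)⁻¹ : ℝ) -
            Real.log (borelHeight ((quasiSplit F E c 3).toAdelic w * (x.out : (quasiSplit F E c 3).Adelic)⁻¹) : ℝ))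
        ∂(quotientMeasure (torusAdelic F E c 3) ρ isClosed_torusAdelic νG) := by
  haveI := t2Space_quasiSplitAdelic (F := F) (E := E) (c := c) (N := 3)
  haveI := locallyCompactSpace_quasiSplitAdelic (F := F) (E := E) (c := c) (N := 3)
  haveI := secondCountableTopology_quasiSplitAdelic (F := F) (E := E) (c := c) (N := 3)
  haveI hTc : IsClosed ((torusAdelic F E c 3 : Set (quasiSplit F E c 3).Adelic)) := isClosed_torusAdelic
  -- the truncation indicator and the group-side integrand `Ψ`
  set U : (quasiSplit F E c 3).Adelic → ℝ≥0∞ := {g : (quasiSplit F E c 3).Adelic | borelHeight g ≤ T ∧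
      borelHeight ((quasiSplit F E c 3).toAdelic w * g) ≤ T}.indicator 1 with hU
  have hU1 : MeasurableSet {g : (quasiSplit F E c 3).Adelic | borelHeight g ≤ T} :=
    measurableSet_le measurable_borelHeight measurable_const
  have hU2 : MeasurableSet {g : (quasiSplit F E c 3).Adelic | borelHeight ((quasiSplit F E c 3).toAdelic w * g) ≤ T} :=
    measurableSet_le (measurable_borelHeight.comp (measurable_const_mul _)) measurable_const
  have hUset : MeasurableSet {g : (quasiSplit F E c 3).Adelic | borelHeight g ≤ T ∧
      borelHeight ((quasiSplit F E c 3).toAdelic w * g) ≤ T} := by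
    rw [Set.setOf_and]; exact hU1.inter hU2
  have hUm : Measurable U := measurable_one.indicator hUset
  set Ψ : (quasiSplit F E c 3).Adelic → ℝ≥0∞ := fun g => β g⁻¹ * ‖f (g * γ * g⁻¹)‖ₑ * U g⁻¹ with hΨ
  have hΨm : Measurable Ψ :=
    ((hβm.comp measurable_inv).mul
      ((hf.comp ((measurable_id.mul_const γ).mul measurable_inv)).enorm)).mul (hUm.comp measurable_inv)
  -- `∫ β(g) ‖f(g⁻¹γg)‖ U(g) = ∫ Ψ(g⁻¹) = ∫ Ψ`
  have hinv : ∫⁻ g, β g * ‖f (g⁻¹ * γ * g)‖ₑ * U g ∂νG = ∫⁻ g, Ψ g ∂νG := by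
    rw [← lintegral_inv_eq_self (μ := νG) Ψ]
    refine lintegral_congr fun g => ?_
    simp only [hΨ, inv_inv]
  rw [hinv, ← lintegral_fiberLIntegral_quotientMeasure (torusAdelic F E c 3) ρ νG hΨm, ← lintegral_const_mul' _ _ hC]
  refine lintegral_congr fun x => ?_
  -- the fibre over `x = x̃ T(𝔸)`
  conv_lhs => rw [← QuotientGroup.out_eq' x]
  rw [fiberLIntegral_mk]
  set g := (x.out : (quasiSplit F E c 3).Adelic) with hg
  -- `Ψ(g t) = ‖f(g γ g⁻¹)‖ · β(t⁻¹ g⁻¹) U(t⁻¹ g⁻¹)`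
  have hfib : ∀ t : ↥(torusAdelic F E c 3), Ψ (g * t) =
      ‖f (g * γ * g⁻¹)‖ₑ * (β ((t : (quasiSplit F E c 3).Adelic)⁻¹ * g⁻¹) * U ((t : (quasiSplit F E c 3).Adelic)⁻¹ * g⁻¹)) := by
    intro t
    have htγ : (t : (quasiSplit F E c 3).Adelic) * γ = γ * (t : (quasiSplit F E c 3).Adelic) :=
      mul_comm_of_mem_torusAdelic t.2 hγ
    have hconj : g * (t : (quasiSplit F E c 3).Adelic) * γ * (((t : (quasiSplit F E c 3).Adelic))⁻¹ * g⁻¹) = g * γ * g⁻¹ := by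
      simp only [mul_assoc]
      rw [← mul_assoc ((t : (quasiSplit F E c 3).Adelic)) γ, htγ, mul_assoc γ, mul_inv_cancel_left]
    simp only [hΨ, mul_inv_rev]
    rw [hconj]
    ring
  simp_rw [hfib]
  rw [lintegral_const_mul' _ _ enorm_ne_top]
  -- inversion on the torus and §2
  have hfibre : ∫⁻ t : ↥(torusAdelic F E c 3), β ((t : (quasiSplit F E c 3).Adelic)⁻¹ * g⁻¹) *
      U ((t : (quasiSplit F E c 3).Adelic)⁻¹ * g⁻¹) ∂ρ =
      C * ENNReal.ofReal (2 * Real.log (T : ℝ) - Real.log (borelHeight g⁻¹ : ℝ) -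
        Real.log (borelHeight ((quasiSplit F E c 3).toAdelic w * g⁻¹) : ℝ)) := by
    have h := lintegral_inv_eq_self (μ := ρ)
      (fun t : ↥(torusAdelic F E c 3) => β ((t : (quasiSplit F E c 3).Adelic) * g⁻¹) * U ((t : (quasiSplit F E c 3).Adelic) * g⁻¹))
    simp only [Subgroup.coe_inv] at h
    rw [h]
    exact lintegral_torusAdelic_weight_mul_indicator_eq hw hT ρ hβT hC hwin g⁻¹
  rw [hfibre, ← mul_assoc, mul_comm _ C, mul_assoc]

end Unfold

/-! ## §4 The signed unfolding along `T(𝔸)` -/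

section UnfoldSigned

variable [MeasurableSpace (quasiSplit F E c 3).Adelic] [BorelSpace (quasiSplit F E c 3).Adelic]
  [MeasurableSpace ((quasiSplit F E c 3).Adelic ⧸ torusAdelic F E c 3)]
  [BorelSpace ((quasiSplit F E c 3).Adelic ⧸ torusAdelic F E c 3)]

/-- **UNFOLDING OF THE WEIGHTED HYPERBOLIC TERM ALONG `T(𝔸)`, SIGNED FORM.** Under the hypotheses of
`lintegral_weight_mul_enorm_conj_mul_indicator_eq` and the finiteness
`hint : ∫⁻_{G⧸T(𝔸)} ‖f(x̃γx̃⁻¹)‖ · (2 log T − log H(x̃⁻¹) − log H(wx̃⁻¹)) d(ν_G/ρ) < ∞` (compact support of the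
regular hyperbolic orbit modulo `T(𝔸)`): the group-side integrand `g ↦ β(g) f(g⁻¹γg) u_T(g)` is
`ν_G`-integrable and
`∫ β(g) f(g⁻¹ γ g) u_T(g) dν_G(g) = C · ∫_{G(𝔸) ⧸ T(𝔸)} f(x̃ γ x̃⁻¹) · (2 log T − log H(x̃⁻¹) − log H(w x̃⁻¹)) d(ν_G/ρ)(x)`
(`u_T` inline; Bochner disintegration ★ `integral_liftMeasure_complex` with ★ `liftMeasure_quotientMeasure`,
and the signed fibre §2) — Rogawski (1990), (6.1.3):
`J_𝔬^T(f) = c·[2 log T · Φ(γ, f) − ∫ f(x̃γx̃⁻¹)(log H + log H∘w)]`.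
[cite: Rogawski1990, §6.1 (6.1.1)–(6.1.3)] [cite: Arthur1978TraceFormulaI, §8] [cite: DeitmarEchterhoff2014, Thm. 1.5.3] -/
theorem integral_weight_toReal_mul_conj_mul_uT_eq
    {γ : (quasiSplit F E c 3).Adelic} (hγ : γ ∈ torusAdelic F E c 3)
    {w : (quasiSplit F E c 3).Rational}
    (hw : ((w.1 : GL (Fin 3) E) : Matrix (Fin 3) (Fin 3) E) = !![(0 : E), 0, 1; 0, 1, 0; 1, 0, 0])
    {T : ℝ≥0} (hT : 1 ≤ T)
    (νG : Measure (quasiSplit F E c 3).Adelic) [νG.IsHaarMeasure] [νG.IsMulRightInvariant] [νG.IsInvInvariant]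
    (ρ : Measure ↥(torusAdelic F E c 3)) [ρ.IsHaarMeasure] [ρ.IsInvInvariant]
    {β : (quasiSplit F E c 3).Adelic → ℝ≥0∞} (hβm : Measurable β)
    (hβT : ∀ y : (quasiSplit F E c 3).Adelic,
      IsCoveringWeight ((rationalBorel F E c 3).subgroupOf (torusInBorel F E c 3))
        (fun s : torusInBorel F E c 3 => β ((((s : borelAdelic F E c 3) : (quasiSplit F E c 3).Adelic)) * y)))
    {C : ℝ≥0∞} (hC : C ≠ ⊤)
    (hwin : ∀ β' : torusInBorel F E c 3 → ℝ≥0∞,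
      IsCoveringWeight ((rationalBorel F E c 3).subgroupOf (torusInBorel F E c 3)) β' →
      ∀ A B : ℝ≥0, 0 < A → A ≤ B →
        ∫⁻ s : torusInBorel F E c 3, β' s * {s : torusInBorel F E c 3 |
            A < borelHeight (((s : torusInBorel F E c 3) : borelAdelic F E c 3) : (quasiSplit F E c 3).Adelic) ∧
            borelHeight (((s : torusInBorel F E c 3) : borelAdelic F E c 3) : (quasiSplit F E c 3).Adelic) ≤ B}.indicator
            1 s ∂(Measure.map (⇑(Subgroup.subgroupOfEquivOfLe
              (torusAdelic_le_borelAdelic (F := F) (E := E) (c := c) (N := 3))).symm) ρ :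
                Measure (torusInBorel F E c 3)) =
          C * ENNReal.ofReal (Real.log (B : ℝ) - Real.log (A : ℝ)))
    {f : (quasiSplit F E c 3).Adelic → ℂ} (hf : Measurable f)
    (hint : ∫⁻ x : (quasiSplit F E c 3).Adelic ⧸ torusAdelic F E c 3,
        ‖f ((x.out : (quasiSplit F E c 3).Adelic) * γ * (x.out : (quasiSplit F E c 3).Adelic)⁻¹)‖ₑ *
          ENNReal.ofReal (2 * Real.log (T : ℝ) - Real.log (borelHeight (x.out : (quasiSplit F E c 3).Adelic)⁻¹ : ℝ) -
            Real.log (borelHeight ((quasiSplit F E c 3).toAdelic w * (x.out : (quasiSplit F E c 3).Adelic)⁻¹) : ℝ))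
        ∂(haveI := t2Space_quasiSplitAdelic (F := F) (E := E) (c := c) (N := 3)
          haveI := locallyCompactSpace_quasiSplitAdelic (F := F) (E := E) (c := c) (N := 3)
          haveI := secondCountableTopology_quasiSplitAdelic (F := F) (E := E) (c := c) (N := 3)
          quotientMeasure (torusAdelic F E c 3) ρ isClosed_torusAdelic νG) < ⊤) :
    haveI := t2Space_quasiSplitAdelic (F := F) (E := E) (c := c) (N := 3)
    haveI := locallyCompactSpace_quasiSplitAdelic (F := F) (E := E) (c := c) (N := 3)
    haveI := secondCountableTopology_quasiSplitAdelic (F := F) (E := E) (c := c) (N := 3)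
    Integrable (fun g => ((β g).toReal : ℂ) * f (g⁻¹ * γ * g) *
        (((1 : ℝ) - {g : (quasiSplit F E c 3).Adelic | T < borelHeight g}.indicator 1 g -
          {g : (quasiSplit F E c 3).Adelic | T < borelHeight g}.indicator 1 ((quasiSplit F E c 3).toAdelic w * g) : ℝ) : ℂ)) νG ∧
    ∫ g, ((β g).toReal : ℂ) * f (g⁻¹ * γ * g) *
        (((1 : ℝ) - {g : (quasiSplit F E c 3).Adelic | T < borelHeight g}.indicator 1 g -
          {g : (quasiSplit F E c 3).Adelic | T < borelHeight g}.indicator 1 ((quasiSplit F E c 3).toAdelic w * g) : ℝ) : ℂ) ∂νG =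
      (C.toReal : ℂ) * ∫ x : (quasiSplit F E c 3).Adelic ⧸ torusAdelic F E c 3,
        f ((x.out : (quasiSplit F E c 3).Adelic) * γ * (x.out : (quasiSplit F E c 3).Adelic)⁻¹) *
          ((2 * Real.log (T : ℝ) - Real.log (borelHeight (x.out : (quasiSplit F E c 3).Adelic)⁻¹ : ℝ) -
            Real.log (borelHeight ((quasiSplit F E c 3).toAdelic w * (x.out : (quasiSplit F E c 3).Adelic)⁻¹) : ℝ) : ℝ) : ℂ)
        ∂(quotientMeasure (torusAdelic F E c 3) ρ isClosed_torusAdelic νG) := by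
  haveI := t2Space_quasiSplitAdelic (F := F) (E := E) (c := c) (N := 3)
  haveI := locallyCompactSpace_quasiSplitAdelic (F := F) (E := E) (c := c) (N := 3)
  haveI := secondCountableTopology_quasiSplitAdelic (F := F) (E := E) (c := c) (N := 3)
  haveI hTc : IsClosed ((torusAdelic F E c 3 : Set (quasiSplit F E c 3).Adelic)) := isClosed_torusAdelic
  -- letters
  set U : (quasiSplit F E c 3).Adelic → ℝ≥0∞ := {g : (quasiSplit F E c 3).Adelic | borelHeight g ≤ T ∧
      borelHeight ((quasiSplit F E c 3).toAdelic w * g) ≤ T}.indicator 1 with hU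
  set uT : (quasiSplit F E c 3).Adelic → ℝ := fun g => (1 : ℝ) - {g : (quasiSplit F E c 3).Adelic | T < borelHeight g}.indicator 1 g -
      {g : (quasiSplit F E c 3).Adelic | T < borelHeight g}.indicator 1 ((quasiSplit F E c 3).toAdelic w * g) with huT
  have hU1 : MeasurableSet {g : (quasiSplit F E c 3).Adelic | borelHeight g ≤ T} :=
    measurableSet_le measurable_borelHeight measurable_const
  have hU2 : MeasurableSet {g : (quasiSplit F E c 3).Adelic | borelHeight ((quasiSplit F E c 3).toAdelic w * g) ≤ T} :=
    measurableSet_le (measurable_borelHeight.comp (measurable_const_mul _)) measurable_const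
  have hUset : MeasurableSet {g : (quasiSplit F E c 3).Adelic | borelHeight g ≤ T ∧
      borelHeight ((quasiSplit F E c 3).toAdelic w * g) ≤ T} := by
    rw [Set.setOf_and]; exact hU1.inter hU2
  -- `u_T = 1_{trunc}` as a real function
  have huTind : ∀ g, uT g = {g : (quasiSplit F E c 3).Adelic | borelHeight g ≤ T ∧
      borelHeight ((quasiSplit F E c 3).toAdelic w * g) ≤ T}.indicator (1 : (quasiSplit F E c 3).Adelic → ℝ) g := fun g =>
    uT_eq_indicator_truncated hw hT g
  have huTm : Measurable uT := by
    have : uT = {g : (quasiSplit F E c 3).Adelic | borelHeight g ≤ T ∧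
        borelHeight ((quasiSplit F E c 3).toAdelic w * g) ≤ T}.indicator (1 : (quasiSplit F E c 3).Adelic → ℝ) := funext huTind
    rw [this]; exact measurable_one.indicator hUset
  have huTU : ∀ g, ENNReal.ofReal (uT g) = U g := by
    intro g
    rw [huTind g, hU]
    by_cases h : g ∈ {g : (quasiSplit F E c 3).Adelic | borelHeight g ≤ T ∧ borelHeight ((quasiSplit F E c 3).toAdelic w * g) ≤ T}
    · rw [Set.indicator_of_mem h, Set.indicator_of_mem h, Pi.one_apply, Pi.one_apply, ENNReal.ofReal_one]
    · rw [Set.indicator_of_notMem h, Set.indicator_of_notMem h, ENNReal.ofReal_zero]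
  have huT0 : ∀ g, 0 ≤ uT g := fun g => by
    rw [huTind g]; exact Set.indicator_nonneg (fun _ _ => zero_le_one) g
  -- `β ≤ 1` (a term of a covering sum)
  have hβle : ∀ z, β z ≤ 1 := fun z => by
    have h := (hβT z).le_one 1
    simpa using h
  have hβfin : ∀ z, β z ≠ ⊤ := fun z => ne_top_of_le_ne_top ENNReal.one_ne_top (hβle z)
  -- the complex group-side integrand `Φ`, written as `g ↦ Θ(g⁻¹)` with `Θ(z) = β(z⁻¹) f(zγz⁻¹) u_T(z⁻¹)`
  set Θ : (quasiSplit F E c 3).Adelic → ℂ := fun z => ((β z⁻¹).toReal : ℂ) * f (z * γ * z⁻¹) * ((uT z⁻¹ : ℝ) : ℂ) with hΘ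
  have hΘm : Measurable Θ :=
    ((Complex.measurable_ofReal.comp (ENNReal.measurable_toReal.comp (hβm.comp measurable_inv))).mul
      (hf.comp ((measurable_id.mul_const γ).mul measurable_inv))).mul
      (Complex.measurable_ofReal.comp (huTm.comp measurable_inv))
  have hΦΘ : (fun g => ((β g).toReal : ℂ) * f (g⁻¹ * γ * g) * ((uT g : ℝ) : ℂ)) = fun g => Θ g⁻¹ := by
    funext g; simp only [hΘ, inv_inv]
  -- `‖Θ‖ₑ = Ψ` of §3
  have hΘnorm : ∀ z, ‖Θ z‖ₑ = β z⁻¹ * ‖f (z * γ * z⁻¹)‖ₑ * U z⁻¹ := by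
    intro z
    rw [hΘ]
    simp only
    have hcr : ∀ r : ℝ, ‖(r : ℂ)‖ₑ = ‖r‖ₑ := fun r => by
      rw [enorm_eq_nnnorm, enorm_eq_nnnorm, Complex.nnnorm_real]
    rw [enorm_mul, enorm_mul, hcr, hcr, Real.enorm_eq_ofReal ENNReal.toReal_nonneg,
      ENNReal.ofReal_toReal (hβfin _), Real.enorm_eq_ofReal (huT0 _), huTU]
  -- integrability of `Θ` w.r.t. `ν_G` from §3 and `hint`
  have hlin := lintegral_weight_mul_enorm_conj_mul_indicator_eq hγ hw hT νG ρ hβm hβT hC hwin hf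
  have hΘint : Integrable Θ νG := by
    refine ⟨hΘm.aestronglyMeasurable, ?_⟩
    rw [hasFiniteIntegral_iff_enorm]
    have h1 : ∫⁻ z, ‖Θ z‖ₑ ∂νG = ∫⁻ g, β g * ‖f (g⁻¹ * γ * g)‖ₑ * U g ∂νG := by
      rw [← lintegral_inv_eq_self (μ := νG) (fun z => ‖Θ z‖ₑ)]
      refine lintegral_congr fun g => ?_
      rw [hΘnorm, inv_inv]
    rw [h1, hlin]
    exact ENNReal.mul_lt_top hC.lt_top hint
  have hΦint : Integrable (fun g => Θ g⁻¹) νG := hΘint.comp_inv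
  refine ⟨by rw [hΦΘ]; exact hΦint, ?_⟩
  rw [hΦΘ, integral_inv_eq_self (fun z => Θ z) νG]
  -- Weil (Bochner) along `T(𝔸)`
  have hlift : Integrable Θ (liftMeasure (torusAdelic F E c 3) ρ (quotientMeasure (torusAdelic F E c 3) ρ hTc νG)) := by
    rw [liftMeasure_quotientMeasure]; exact hΘint
  have hW := integral_liftMeasure_complex (torusAdelic F E c 3) ρ (quotientMeasure (torusAdelic F E c 3) ρ hTc νG) hΘm hlift
  rw [liftMeasure_quotientMeasure] at hW
  rw [hW, ← integral_const_mul]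
  refine integral_congr_ae (Eventually.of_forall fun x => ?_)
  -- the fibre over `x = x̃ T(𝔸)`
  conv_lhs => rw [← QuotientGroup.out_eq' x]
  rw [fiberIntegralE_mk]
  set g := (x.out : (quasiSplit F E c 3).Adelic) with hg
  have hfib : ∀ t : ↥(torusAdelic F E c 3), Θ (g * t) =
      f (g * γ * g⁻¹) * (((β ((t : (quasiSplit F E c 3).Adelic)⁻¹ * g⁻¹)).toReal : ℂ) *
        ((uT ((t : (quasiSplit F E c 3).Adelic)⁻¹ * g⁻¹) : ℝ) : ℂ)) := by
    intro t
    have htγ : (t : (quasiSplit F E c 3).Adelic) * γ = γ * (t : (quasiSplit F E c 3).Adelic) :=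
      mul_comm_of_mem_torusAdelic t.2 hγ
    have hconj : g * (t : (quasiSplit F E c 3).Adelic) * γ * (((t : (quasiSplit F E c 3).Adelic))⁻¹ * g⁻¹) = g * γ * g⁻¹ := by
      simp only [mul_assoc]
      rw [← mul_assoc ((t : (quasiSplit F E c 3).Adelic)) γ, htγ, mul_assoc γ, mul_inv_cancel_left]
    simp only [hΘ, mul_inv_rev]
    rw [hconj]
    ring
  simp_rw [hfib]
  rw [integral_const_mul]
  -- inversion on the torus and the signed fibre §2
  have hfibre : ∫ t : ↥(torusAdelic F E c 3), (((β ((t : (quasiSplit F E c 3).Adelic)⁻¹ * g⁻¹)).toReal : ℂ) *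
      ((uT ((t : (quasiSplit F E c 3).Adelic)⁻¹ * g⁻¹) : ℝ) : ℂ)) ∂ρ =
      ((C.toReal * (2 * Real.log (T : ℝ) - Real.log (borelHeight g⁻¹ : ℝ) -
        Real.log (borelHeight ((quasiSplit F E c 3).toAdelic w * g⁻¹) : ℝ)) : ℝ) : ℂ) := by
    have h := integral_inv_eq_self (fun t : ↥(torusAdelic F E c 3) =>
      (((β ((t : (quasiSplit F E c 3).Adelic) * g⁻¹)).toReal : ℂ) * ((uT ((t : (quasiSplit F E c 3).Adelic) * g⁻¹) : ℝ) : ℂ))) ρ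
    simp only [Subgroup.coe_inv] at h
    rw [h, ← integral_torusAdelic_weight_mul_uT_eq hw hT ρ hβT hC hwin g⁻¹, ← integral_complex_ofReal]
    refine integral_congr_ae (Eventually.of_forall fun t => ?_)
    simp only [huT]
    push_cast
    ring
  rw [hfibre]
  push_cast
  ring

end UnfoldSigned

/-! ## §5 The packaged form: one window constant, both unfoldings -/

section Packaged

variable [MeasurableSpace (quasiSplit F E c 3).Adelic] [BorelSpace (quasiSplit F E c 3).Adelic]
  [MeasurableSpace ((quasiSplit F E c 3).Adelic ⧸ torusAdelic F E c 3)]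
  [BorelSpace ((quasiSplit F E c 3).Adelic ⧸ torusAdelic F E c 3)]

omit [MeasurableSpace ((quasiSplit F E c 3).Adelic ⧸ torusAdelic F E c 3)]
  [BorelSpace ((quasiSplit F E c 3).Adelic ⧸ torusAdelic F E c 3)] in
/-- `e_* ρ` is a Haar measure on `T(𝔸)_B` for a Haar measure `ρ` on `T(𝔸)` (Mathlib
`MulEquiv.isHaarMeasure_map` along the canonical homeomorphic isomorphism). [folklore] -/
private theorem isHaarMeasure_map_torusEquiv (ρ : Measure ↥(torusAdelic F E c 3)) [ρ.IsHaarMeasure] :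
    IsHaarMeasure (Measure.map (⇑(Subgroup.subgroupOfEquivOfLe
      (torusAdelic_le_borelAdelic (F := F) (E := E) (c := c) (N := 3))).symm) ρ : Measure (torusInBorel F E c 3)) :=
  MulEquiv.isHaarMeasure_map ρ _
    (continuous_subgroupOfEquivOfLe_symm _ _ (torusAdelic_le_borelAdelic (F := F) (E := E) (c := c) (N := 3)))
    (continuous_subgroupOfEquivOfLe _ _ (torusAdelic_le_borelAdelic (F := F) (E := E) (c := c) (N := 3)))

/-- **THE TORUS FIBRE OF THE WEIGHTED HYPERBOLIC TERM (packaged).** For `[E:F] = 2`, `c² = 1`, `c ≠ 1`,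
`γ ∈ T(𝔸)`, the Weyl element `w`, Haar measures `ν_G` (right and inversion invariant) on `G(𝔸_F)` and `ρ`
(inversion invariant) on `T(𝔸)`, and a Borel `β ≥ 0` on `G(𝔸_F)` whose torus translates `s ↦ β(s y)` are
covering weights of the rational torus `T(F)_T` (★ `isCoveringWeight_torus_translate`), there is ONE
constant `C < ∞` — the torus window constant of `μ_T := e_* ρ` (★ `exists_rankOneInterval_forall_weight`;
the slope of the `2 log T` term of LAW 2) — such that (i) the window law holds for every covering weight of
`T(F)_T`, and for every `T ≥ 1` and every Borel `f : G(𝔸_F) → ℂ`: (ii) the `[0,∞]` unfolding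
`∫⁻ β ‖f(g⁻¹γg)‖ 1_{H≤T ∧ H∘w≤T} dν_G = C · ∫⁻_{G⧸T(𝔸)} ‖f(x̃γx̃⁻¹)‖ (2 log T − log H(x̃⁻¹) − log H(wx̃⁻¹))`
and (iii) under `hint` (finiteness of that right-hand side) the integrability of `β f(g⁻¹γg) u_T` and the
signed unfolding
`∫ β f(g⁻¹γg) u_T dν_G = C · ∫_{G⧸T(𝔸)} f(x̃γx̃⁻¹) (2 log T − log H(x̃⁻¹) − log H(wx̃⁻¹)) d(ν_G/ρ)`
(Rogawski (1990), (6.1.1)–(6.1.3)). [cite: Rogawski1990, §6.1 (6.1.1)–(6.1.3)] [cite: Arthur1978TraceFormulaI, §8]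
[cite: DeitmarEchterhoff2014, Thm. 1.5.3] -/
theorem exists_torusFibre_unfolding (h2 : Module.finrank F E = 2) (hc : c * c = 1) (hc1 : c ≠ 1)
    {γ : (quasiSplit F E c 3).Adelic} (hγ : γ ∈ torusAdelic F E c 3)
    {w : (quasiSplit F E c 3).Rational}
    (hw : ((w.1 : GL (Fin 3) E) : Matrix (Fin 3) (Fin 3) E) = !![(0 : E), 0, 1; 0, 1, 0; 1, 0, 0])
    (νG : Measure (quasiSplit F E c 3).Adelic) [νG.IsHaarMeasure] [νG.IsMulRightInvariant] [νG.IsInvInvariant]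
    (ρ : Measure ↥(torusAdelic F E c 3)) [ρ.IsHaarMeasure] [ρ.IsInvInvariant]
    {β : (quasiSplit F E c 3).Adelic → ℝ≥0∞} (hβm : Measurable β)
    (hβT : ∀ y : (quasiSplit F E c 3).Adelic,
      IsCoveringWeight ((rationalBorel F E c 3).subgroupOf (torusInBorel F E c 3))
        (fun s : torusInBorel F E c 3 => β ((((s : borelAdelic F E c 3) : (quasiSplit F E c 3).Adelic)) * y))) :
    haveI := t2Space_quasiSplitAdelic (F := F) (E := E) (c := c) (N := 3)
    haveI := locallyCompactSpace_quasiSplitAdelic (F := F) (E := E) (c := c) (N := 3)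
    haveI := secondCountableTopology_quasiSplitAdelic (F := F) (E := E) (c := c) (N := 3)
    ∃ C : ℝ≥0∞, C ≠ ⊤ ∧
      (∀ β' : torusInBorel F E c 3 → ℝ≥0∞,
        IsCoveringWeight ((rationalBorel F E c 3).subgroupOf (torusInBorel F E c 3)) β' →
        ∀ A B : ℝ≥0, 0 < A → A ≤ B →
          ∫⁻ s : torusInBorel F E c 3, β' s * {s : torusInBorel F E c 3 |
              A < borelHeight (((s : torusInBorel F E c 3) : borelAdelic F E c 3) : (quasiSplit F E c 3).Adelic) ∧
              borelHeight (((s : torusInBorel F E c 3) : borelAdelic F E c 3) : (quasiSplit F E c 3).Adelic) ≤ B}.indicator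
              1 s ∂(Measure.map (⇑(Subgroup.subgroupOfEquivOfLe
                (torusAdelic_le_borelAdelic (F := F) (E := E) (c := c) (N := 3))).symm) ρ :
                  Measure (torusInBorel F E c 3)) =
            C * ENNReal.ofReal (Real.log (B : ℝ) - Real.log (A : ℝ))) ∧
      ∀ (T : ℝ≥0), 1 ≤ T → ∀ (f : (quasiSplit F E c 3).Adelic → ℂ), Measurable f →
        (∫⁻ g, β g * ‖f (g⁻¹ * γ * g)‖ₑ *
            {g : (quasiSplit F E c 3).Adelic | borelHeight g ≤ T ∧
              borelHeight ((quasiSplit F E c 3).toAdelic w * g) ≤ T}.indicator 1 g ∂νG =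
          C * ∫⁻ x : (quasiSplit F E c 3).Adelic ⧸ torusAdelic F E c 3,
            ‖f ((x.out : (quasiSplit F E c 3).Adelic) * γ * (x.out : (quasiSplit F E c 3).Adelic)⁻¹)‖ₑ *
              ENNReal.ofReal (2 * Real.log (T : ℝ) - Real.log (borelHeight (x.out : (quasiSplit F E c 3).Adelic)⁻¹ : ℝ) -
                Real.log (borelHeight ((quasiSplit F E c 3).toAdelic w * (x.out : (quasiSplit F E c 3).Adelic)⁻¹) : ℝ))
            ∂(quotientMeasure (torusAdelic F E c 3) ρ isClosed_torusAdelic νG)) ∧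
        (∫⁻ x : (quasiSplit F E c 3).Adelic ⧸ torusAdelic F E c 3,
            ‖f ((x.out : (quasiSplit F E c 3).Adelic) * γ * (x.out : (quasiSplit F E c 3).Adelic)⁻¹)‖ₑ *
              ENNReal.ofReal (2 * Real.log (T : ℝ) - Real.log (borelHeight (x.out : (quasiSplit F E c 3).Adelic)⁻¹ : ℝ) -
                Real.log (borelHeight ((quasiSplit F E c 3).toAdelic w * (x.out : (quasiSplit F E c 3).Adelic)⁻¹) : ℝ))
            ∂(quotientMeasure (torusAdelic F E c 3) ρ isClosed_torusAdelic νG) < ⊤ →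
          Integrable (fun g => ((β g).toReal : ℂ) * f (g⁻¹ * γ * g) *
              (((1 : ℝ) - {g : (quasiSplit F E c 3).Adelic | T < borelHeight g}.indicator 1 g -
                {g : (quasiSplit F E c 3).Adelic | T < borelHeight g}.indicator 1 ((quasiSplit F E c 3).toAdelic w * g) : ℝ) : ℂ)) νG ∧
          ∫ g, ((β g).toReal : ℂ) * f (g⁻¹ * γ * g) *
              (((1 : ℝ) - {g : (quasiSplit F E c 3).Adelic | T < borelHeight g}.indicator 1 g -
                {g : (quasiSplit F E c 3).Adelic | T < borelHeight g}.indicator 1 ((quasiSplit F E c 3).toAdelic w * g) : ℝ) : ℂ) ∂νG =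
            (C.toReal : ℂ) * ∫ x : (quasiSplit F E c 3).Adelic ⧸ torusAdelic F E c 3,
              f ((x.out : (quasiSplit F E c 3).Adelic) * γ * (x.out : (quasiSplit F E c 3).Adelic)⁻¹) *
                ((2 * Real.log (T : ℝ) - Real.log (borelHeight (x.out : (quasiSplit F E c 3).Adelic)⁻¹ : ℝ) -
                  Real.log (borelHeight ((quasiSplit F E c 3).toAdelic w * (x.out : (quasiSplit F E c 3).Adelic)⁻¹) : ℝ) : ℝ) : ℂ)
              ∂(quotientMeasure (torusAdelic F E c 3) ρ isClosed_torusAdelic νG)) := by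
  haveI := t2Space_quasiSplitAdelic (F := F) (E := E) (c := c) (N := 3)
  haveI := locallyCompactSpace_quasiSplitAdelic (F := F) (E := E) (c := c) (N := 3)
  haveI := secondCountableTopology_quasiSplitAdelic (F := F) (E := E) (c := c) (N := 3)
  haveI := isHaarMeasure_map_torusEquiv (F := F) (E := E) (c := c) ρ
  -- the window constant of `μ_T := e_* ρ`, fixed with the translated weight at `y = 1`
  obtain ⟨C, hC, hwin⟩ := exists_rankOneInterval_forall_weight h2 hc hc1 hw
    (Measure.map (⇑(Subgroup.subgroupOfEquivOfLe
      (torusAdelic_le_borelAdelic (F := F) (E := E) (c := c) (N := 3))).symm) ρ : Measure (torusInBorel F E c 3))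
    (hβT 1)
  have hwin' : ∀ β' : torusInBorel F E c 3 → ℝ≥0∞,
      IsCoveringWeight ((rationalBorel F E c 3).subgroupOf (torusInBorel F E c 3)) β' →
      ∀ A B : ℝ≥0, 0 < A → A ≤ B →
        ∫⁻ s : torusInBorel F E c 3, β' s * {s : torusInBorel F E c 3 |
            A < borelHeight (((s : torusInBorel F E c 3) : borelAdelic F E c 3) : (quasiSplit F E c 3).Adelic) ∧
            borelHeight (((s : torusInBorel F E c 3) : borelAdelic F E c 3) : (quasiSplit F E c 3).Adelic) ≤ B}.indicator
            1 s ∂(Measure.map (⇑(Subgroup.subgroupOfEquivOfLe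
              (torusAdelic_le_borelAdelic (F := F) (E := E) (c := c) (N := 3))).symm) ρ :
                Measure (torusInBorel F E c 3)) =
          C * ENNReal.ofReal (Real.log (B : ℝ) - Real.log (A : ℝ)) := fun β' hβ' => (hwin β' hβ').1
  refine ⟨C, hC, hwin', fun T hT f hf => ⟨?_, fun hint => ?_⟩⟩
  · exact lintegral_weight_mul_enorm_conj_mul_indicator_eq hγ hw hT νG ρ hβm hβT hC hwin' hf
  · exact integral_weight_toReal_mul_conj_mul_uT_eq hγ hw hT νG ρ hβm hβT hC hwin' hf hint

end Packaged

end UnitaryGroup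

end Literature.NumberTheory.Automorphic
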